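import Summits.CriticalPhenomena.PercolationContinuityZ3.Theorems.PercNearOneGluingNoHeavyLowerTailSahiOneStepUniformPrelim
import HarnessLib

/-!
# One-step scheme: the PARTNER-RELATIVE hull (`♯`-hull) never increases `n`

Support file (prover prim-ineq-prove-3 gen 52; `--supports stmt-CriticalPhenomena-4575`; memo
`run/shared/lean/prim/prim-ineq-prove-3/FINDING-G52-SHARP-REDUCTION.md` §1).  No definitions, no named facts, no sorries.

Setting (`…SahiOneStepCone`): `μ = prodBernoulli p`, first slot `H` (increasing), `n(H;A,B) = osN p H (ind A) (ind B)
= μ(A∩L)μ(B∩L) + μ(L)·μ(A∩B∩H) − μ(L)·μ(A)μ(B)` (`L = Hᶜ`).  Gen 21 (`osN_ind_ind_hgen_le`) showed that replacing `A` by its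
`H`-generated hull `{ω | every ω' ⊇ ω in H lies in A}` does not increase `n`.  Here the hull is taken relative to the PARTNER:

* **`♯`-hull** of `A` with respect to `(H, B)`: `A♯ = {ω | every ω' ⊇ ω with ω' ∈ H ∩ B lies in A}` (written out in full, no definition).
  It is increasing, contains `A` and the `H`-hull of `A`, and has the same trace on `H ∩ B` as `A`.
* **`n(H; A♯, B) ≤ n(H; A, B)`** for increasing `H, A, B` (`osN_ind_ind_sharpHull_le`, and the symmetric `…_right`): as a function of the
  indicator of `A`, the coefficient of a point outside `B ∩ H` is `1_L·μ(B∩L) − μ(L)μ(B) ≤ μ(B∩L) − μ(L)μ(B) ≤ 0` (Harris), so adding such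
  points can only lower `n`.  In the proof: with `x = μ(H∩A♯) − μ(H∩A) ≥ 0`, `y = μ(A♯) − μ(A) ≥ 0`,
  `n(A,B) − n(A♯,B) = x·(μB − μ(H∩B)) + y·(μ(H∩B) − μH·μB) ≥ 0`.

Consequence (memo §1, the `♯`-NORMAL FORM): when proving `n(H;A,B) ≥ 0` for all increasing pairs one may assume
`A = A♯(B)` and `B = B♯(A)`, i.e. every maximal non-member of `A` lies in `B ∩ H` and every maximal non-member of `B` lies in `A ∩ H`
(alternate the two hulls; the sets only grow).  This is strictly stronger than `H`-generation and is valid for EVERY product measure.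
-/

noncomputable section

namespace Summit.CriticalPhenomena.PercolationContinuityZ3.Theorems

namespace SahiOneStep

open MeasureTheory
open Literature.Probability.LatticeModels (prodBernoulli prodBernoulli_harris)
open Literature.Probability.Percolation.DecisionTree (ind)
open scoped Classical

variable {ι : Type*} [Fintype ι]

omit [Fintype ι] in
/-- The `♯`-hull (relative to `H ∩ B`) contains the plain `H`-hull: fewer supersets are constrained. [this work] -/
theorem hgen_subset_sharpHull (H B A : Set (Set ι)) :
    {ω : Set ι | ∀ ω' : Set ι, ω ⊆ ω' → ω' ∈ H → ω' ∈ A} ⊆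
      {ω : Set ι | ∀ ω' : Set ι, ω ⊆ ω' → ω' ∈ H ∩ B → ω' ∈ A} :=
  fun _ h ω' hsub hHB => h ω' hsub hHB.1

omit [Fintype ι] in
/-- The `♯`-hull has the same trace on `H ∩ B` as the event, written as a triple intersection. [this work] -/
theorem inter_sharpHull_inter_eq (H B : Set (Set ι)) {A : Set (Set ι)} (hA : IsUpperSet A) :
    H ∩ {ω : Set ι | ∀ ω' : Set ι, ω ⊆ ω' → ω' ∈ H ∩ B → ω' ∈ A} ∩ B = H ∩ A ∩ B := by
  ext ω
  constructor
  · rintro ⟨⟨hH, hg⟩, hB⟩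
    exact ⟨⟨hH, hg ω subset_rfl ⟨hH, hB⟩⟩, hB⟩
  · rintro ⟨⟨hH, hAω⟩, hB⟩
    exact ⟨⟨hH, subset_hgen (H ∩ B) hA hAω⟩, hB⟩

/-- **The partner-relative hull does not increase `n`**: for increasing `H, A, B`,
`n(H; A♯, B) ≤ n(H; A, B)` where `A♯ = {ω | ∀ ω' ⊇ ω, ω' ∈ H ∩ B → ω' ∈ A}`.  Points outside `B ∩ H` have a nonpositive coefficient
in `n(H; ·, B)` (Harris for `B` against `L = Hᶜ`), and `A♯ ∖ A` consists of such points. [this work] -/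
theorem osN_ind_ind_sharpHull_le (p : ι → unitInterval) {H A B : Set (Set ι)} (hH : IsUpperSet H) (hA : IsUpperSet A)
    (hB : IsUpperSet B) :
    osN p H (ind {ω : Set ι | ∀ ω' : Set ι, ω ⊆ ω' → ω' ∈ H ∩ B → ω' ∈ A}) (ind B) ≤ osN p H (ind A) (ind B) := by
  rw [osN_ind_ind, osN_ind_ind, inter_sharpHull_inter_eq H B hA]
  have hsub : A ⊆ {ω : Set ι | ∀ ω' : Set ι, ω ⊆ ω' → ω' ∈ H ∩ B → ω' ∈ A} := subset_hgen (H ∩ B) hA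
  have hy : (prodBernoulli p).real A ≤ (prodBernoulli p).real {ω : Set ι | ∀ ω' : Set ι, ω ⊆ ω' → ω' ∈ H ∩ B → ω' ∈ A} :=
    measureReal_mono hsub
  have hx : (prodBernoulli p).real (H ∩ A) ≤
      (prodBernoulli p).real (H ∩ {ω : Set ι | ∀ ω' : Set ι, ω ⊆ ω' → ω' ∈ H ∩ B → ω' ∈ A}) :=
    measureReal_mono (Set.inter_subset_inter_right H hsub)
  have hHarris : (prodBernoulli p).real H * (prodBernoulli p).real B ≤ (prodBernoulli p).real (H ∩ B) :=
    prodBernoulli_harris p hH hB MeasurableSet.of_discrete MeasurableSet.of_discrete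
  have hHB : (prodBernoulli p).real (H ∩ B) ≤ (prodBernoulli p).real B := measureReal_mono Set.inter_subset_right
  nlinarith [mul_nonneg (sub_nonneg.2 hx) (sub_nonneg.2 hHB), mul_nonneg (sub_nonneg.2 hy) (sub_nonneg.2 hHarris)]

/-- The symmetric form: `n(H; A, B♯) ≤ n(H; A, B)` with `B♯ = {ω | ∀ ω' ⊇ ω, ω' ∈ H ∩ A → ω' ∈ B}`. [this work] -/
theorem osN_ind_ind_sharpHull_le_right (p : ι → unitInterval) {H A B : Set (Set ι)} (hH : IsUpperSet H) (hA : IsUpperSet A)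
    (hB : IsUpperSet B) :
    osN p H (ind A) (ind {ω : Set ι | ∀ ω' : Set ι, ω ⊆ ω' → ω' ∈ H ∩ A → ω' ∈ B}) ≤ osN p H (ind A) (ind B) := by
  rw [osN_comm p H (ind A), osN_comm p H (ind A)]
  exact osN_ind_ind_sharpHull_le p hH hB hA

/-- **`(2′)` transfers from the `♯`-reduced pair.**  If `n(H; A♯, B) ≥ 0` for the partner-relative hull `A♯` of `A`, then `n(H; A, B) ≥ 0`;
use with `…_right` alternately to reach the `♯`-normal form of the memo (both hulls are fixpoints). [this work] -/
theorem osN_ind_ind_nonneg_of_sharpHull (p : ι → unitInterval) {H A B : Set (Set ι)} (hH : IsUpperSet H) (hA : IsUpperSet A)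
    (hB : IsUpperSet B)
    (h : 0 ≤ osN p H (ind {ω : Set ι | ∀ ω' : Set ι, ω ⊆ ω' → ω' ∈ H ∩ B → ω' ∈ A}) (ind B)) :
    0 ≤ osN p H (ind A) (ind B) :=
  h.trans (osN_ind_ind_sharpHull_le p hH hA hB)

/-- **Characterisation of the `♯`-fixpoints**: `A` equals its `♯`-hull relative to `(H, B)` iff every non-member of `A` lies below a
non-member of `A` that belongs to `H ∩ B` — equivalently, every MAXIMAL non-member of `A` lies in `B ∩ H`. [this work] -/
theorem sharpHull_subset_iff (H B A : Set (Set ι)) :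
    {ω : Set ι | ∀ ω' : Set ι, ω ⊆ ω' → ω' ∈ H ∩ B → ω' ∈ A} ⊆ A ↔
      ∀ ω : Set ι, ω ∉ A → ∃ ω' : Set ι, ω ⊆ ω' ∧ ω' ∈ H ∩ B ∧ ω' ∉ A := by
  constructor
  · intro h ω hω
    by_contra hne
    push Not at hne
    exact hω (h (fun ω' hsub hHB => hne ω' hsub hHB))
  · intro h ω hω
    by_contra hωA
    obtain ⟨ω', hsub, hHB, hno⟩ := h ω hωA
    exact hno (hω ω' hsub hHB)

end SahiOneStep

end Summit.CriticalPhenomena.PercolationContinuityZ3.Theorems
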